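import Summits.AtomisticToContinuum.FouriersLaw.Theorems.BondHeatUncertaintyExtensiveSnapshotIrreversibilityEnergyWindowAtoms
import Summits.AtomisticToContinuum.FouriersLaw.Theorems.BondHeatUncertaintyExtensiveSnapshotIrreversibilityEnergyWindowExpMoment

/-!
# Crux `ExtensiveSnapshotIrreversibility` (stmt-AtomisticToContinuum-9121): atom A1 discharged in the glue of `(W)`

Cell decomp-a2c, lens «grading / quantitative ladder», generation 72. Bridge between the atoms file
`…EnergyWindowAtoms.lean` (A0–A4, glue `energyWindowControl_of_atoms : A0 → A1 → A2 → A3 → A4 → (W)`)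
and `…EnergyWindowExpMoment.lean` (atom A1 proved as the closed statement `nessExpMomentBound_atom`,
verbatim the text of `NessExpMomentBound`):

* `nessExpMomentBound_holds : NessExpMomentBound` — **atom A1 PROVED** (Cuneo–Eckmann–Hairer–Rey-Bellet
  2018 Thm 2.13 (2) / Rem 5.2 with a temperature-uniform drift constant, invariance of the
  Krylov–Bogoliubov steady state, weak-NESS uniqueness);
* `energyWindowControl_of_atoms₄ : A0 → A2 → A3 → A4 → (W)` and
  `snapshotKLUpperExpansion_of_atoms₄ : A0 → A2 → A3 → A4 → K_fix` — the ladder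
  `K_fix ⟸ (W) ⟸ A0 ∧ A2 ∧ A3 ∧ A4` with A1 no longer a hypothesis (A0 is a tree theorem,
  `ClausiusBudget.LogDensity.ness_eq_gibbs_withDensity_exp`, to be discharged by import once its
  module is built; open leaves: A2, A3, A4).

References: N. Cuneo, J.-P. Eckmann, M. Hairer, L. Rey-Bellet, EJP 23 (2018) no. 55, Thm 2.13, Rem 5.2.
-/

noncomputable section

namespace Summit.AtomisticToContinuum.FouriersLaw.Theorems.ExtensiveSnapshotIrreversibility.EnergyWindow

/-- **Atom A1 `NessExpMomentBound` holds** (the `δ`-uniform exponential energy moment of the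
steady-state family along the window `(T + δ/2, T − δ/2)`: `δ₀ = T`, `θ = 1/(4T)`).
[cite: CuneoEckmannHairerReyBellet2018, Thm 2.13 (2) and Rem 5.2] -/
theorem nessExpMomentBound_holds : NessExpMomentBound := nessExpMomentBound_atom

/-- **The glue with A1 discharged**: `A0 → A2 → A3 → A4 → (W)`. [folklore] -/
theorem energyWindowControl_of_atoms₄ (h0 : NessGibbsReweighting) (h2 : NessOddLogRatioBound)
    (h3 : NessDensityFloor) (h4 : NessLinearResponseL2) : EnergyWindowControl :=
  energyWindowControl_of_atoms h0 nessExpMomentBound_holds h2 h3 h4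

/-- **Hence `K_fix` from A0, A2, A3, A4**: `A0 → A2 → A3 → A4 → SnapshotKLUpperExpansion`
(composition with `snapshotKLUpperExpansion_of_energyWindow : (W) → K_fix`). [folklore] -/
theorem snapshotKLUpperExpansion_of_atoms₄ (h0 : NessGibbsReweighting) (h2 : NessOddLogRatioBound)
    (h3 : NessDensityFloor) (h4 : NessLinearResponseL2) : SnapshotKLUpperExpansion :=
  snapshotKLUpperExpansion_of_energyWindow (energyWindowControl_of_atoms₄ h0 h2 h3 h4)

end Summit.AtomisticToContinuum.FouriersLaw.Theorems.ExtensiveSnapshotIrreversibility.EnergyWindow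

end
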